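import Literature.MathematicalPhysics.QuantumFieldTheory.Balaban1983to89.T3ThresholdSmallness
import HarnessLib

/-!
# `Balaban1983to89.T3Thresholds` — rung R3, cruxes K1/K2: the arithmetic of Bałaban's thresholds `θ(i) = g_i·p(g_i)`
# (`T3UnitScaleTilt.θBal`) — uniform smallness in `γ`, decay in `i`, monotonicity — behind every «`B₃θ ≤ ε₀` for `γ` small» step

Cell `ym3-torus` (HUMAN RULING D-0037, YM ladder rung R3), seat `ym3-torus-p1` gen 6 (UV side).  WHAT THIS IS NOT: no estimate of
[Balaban1985UV3]; everything here is [folklore]-level real analysis about the printed window function `p(g) = b₀(1 + log g⁻¹)^{p₀}`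
((7) p. 257, tree `B10.pFun`) composed with the d = 3 effective coupling `g_i = √(γL^{-i})` at distance `i` from the unit scale
((3)/(5) p. 256: `g_k² = g²L^kε`), i.e. about `θBal L γ b₀ p₀ i = g_i·p(g_i)` (tree `T3UnitScaleTilt.θBal`, the radius of the
small-field events `histGood` and of hypothesis (7) of [Balaban1985Variational] Thm 1 in the K1 stubs `HasRegMinimisersPrAt` /
`UpperAlongRegPrMinimisersAt` / `LowerAlongRegPrMinimisersAt`).

WHY.  Every use of [Balaban1985Variational] Thm 1 / [Balaban1985Averaging] Lemma 1 along the d = 3 run needs `B₃ε₁ ≤ ε₀` with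
`ε₁ = θ(i)` ([Balaban1985UV3] p. 259 (13), p. 267 L9 «for g_{k−1} sufficiently small», p. 268), and the route's quantifier prefix
fixes `ε₀` BEFORE `γ₁` (tree `T3PrintedRegularMinimiser.unitTilt_shape_of_regPr`).  The QUALITATIVE facts — `θ(i) → 0` uniformly in `i`
as `γ → 0` (`exists_forall_θBal_le`) and in `i → ∞` at fixed `γ` (`tendsto_θBal_atTop`) — are `T3ThresholdSmallness` (p416089, same
seat gen 5); this module adds, on top of it and without restating it (cell memo HOME/UV3-NODE.md §13):
* §1 the coupling `g_i = √(γL^{-i})`: `g_i ≤ 1`, `g_{i+1} ≤ g_i`, `g_j ≤ g_i` (`i ≤ j`);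
* §2 the EXPLICIT RATE **`θBal_le_const_mul_sqrt_coupling`**: `θ(i) ≤ b₀(2p₀)^{p₀}e^{½−p₀}·√g_i` (the tangent-line bound
  `B10.rpow_mul_exp_neg_le` with `c = ½`, as in the lane's `CouplingWindow.gp_le_sqrt` for the printed flow) ⇒ **`θBal_le_const_mul_rpow`**:
  `θ(i) ≤ C(b₀,p₀)·γ^{1/4}` UNIFORMLY in `i` AND `L ≥ 1` ⇒ **`θBal_le_of_le_gamma`** (ONE explicit threshold) and
  **`exists_gamma_forall_θBal_le`** / **`exists_gamma_forall_mul_θBal_le`**: `∀ ε₀ > 0, ∃ γ₁ ∈ (0,1], ∀ L ≥ 1, ∀ γ ∈ (0,γ₁], ∀ i,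
  B·θ(i) ≤ ε₀` — the form the stubs consume («`B₃θ ≤ ε₀`», «`C·L·B₃θ ≤ ε₀`»);
* §3 the «from some `K₀` on» form at FIXED `γ` (`L > 1`, `0 < m`): **`eventually_θBal_div_le`** / **`eventually_mul_θBal_div_le`**
  (`∀ ε₀ > 0, ∃ K₀, ∀ K ≥ K₀, B·θ(⌊K/m⌋) ≤ ε₀`) — the `∃ K₀` of the `…At` schemas;
* §4 MONOTONICITY: `g ↦ g·p(g)` is INCREASING on `(0, e^{1−p₀}]` (`gp_le_gp_of_le`), hence **`θBal_succ_le`** / **`θBal_antitone`** /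
  **`θBal_le_θBal_zero`** once `√γ ≤ e^{1−p₀}` (d/dg[g(1 + log g⁻¹)^{p₀}] > 0 iff log g⁻¹ > p₀ − 1; `sqrt_le_exp_iff`).

References: T. Bałaban, «Ultraviolet stability of three-dimensional lattice pure gauge field theories», Commun. Math. Phys. 102 (1985)
255–275 [Balaban1985UV3] ((3)/(5) p.256, (7) p.257, (13) p.259, p.267–268); «The variational problem and background fields in
renormalization group method for lattice gauge theories», CMP 102 (1985) 277–309 [Balaban1985Variational] (Thm 1 p.279: `B₃ε₁ ≤ ε₀`).
-/

noncomputable section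

open Filter Topology
open Literature.MathematicalPhysics.QuantumFieldTheory.Balaban1983to89.T3UnitScaleTilt (θBal)
open Literature.MathematicalPhysics.QuantumFieldTheory.Balaban1983to89.T3MinimiserStabilityReduction (θBal_pos)
open Literature.MathematicalPhysics.QuantumFieldTheory.Balaban1983to89.T3ThresholdSmallness (sqrt_coupling_pos_le exists_forall_θBal_le tendsto_θBal_atTop)

namespace Literature.MathematicalPhysics.QuantumFieldTheory.Balaban1983to89.T3Thresholds

/-! ## §1 The effective coupling `g_i = √(γL^{-i})` at distance `i` from the unit scale -/

section Coupling

variable {L : ℕ} {γ : ℝ}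

/-- `0 ≤ L⁻¹ ≤ 1` for `L ≥ 1` (private plumbing). [folklore] -/
private theorem inv_nonneg_le_one (hL : 1 ≤ L) : 0 ≤ (L : ℝ)⁻¹ ∧ (L : ℝ)⁻¹ ≤ 1 :=
  ⟨inv_nonneg.mpr (Nat.cast_nonneg L), inv_le_one_of_one_le₀ (by exact_mod_cast hL)⟩

/-- `g_i ≤ 1` for `0 ≤ γ ≤ 1`, `L ≥ 1`. [cite: Balaban1985UV3, (5) p.256] -/
theorem coupling_le_one (hL : 1 ≤ L) (hγ : 0 < γ) (hγ1 : γ ≤ 1) (i : ℕ) : Real.sqrt (γ * ((L : ℝ)⁻¹) ^ i) ≤ 1 :=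
  (sqrt_coupling_pos_le hL hγ i).2.trans (Real.sqrt_le_one.mpr hγ1)

/-- `g_{i+1} ≤ g_i` (`L ≥ 1`, `γ ≥ 0`). [cite: Balaban1985UV3, (5) p.256] -/
theorem coupling_succ_le (hL : 1 ≤ L) (hγ : 0 ≤ γ) (i : ℕ) :
    Real.sqrt (γ * ((L : ℝ)⁻¹) ^ (i + 1)) ≤ Real.sqrt (γ * ((L : ℝ)⁻¹) ^ i) := by
  refine Real.sqrt_le_sqrt (mul_le_mul_of_nonneg_left ?_ hγ)
  rw [pow_succ]
  exact mul_le_of_le_one_right (pow_nonneg (inv_nonneg_le_one hL).1 i) (inv_nonneg_le_one hL).2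

/-- `g_j ≤ g_i` for `i ≤ j` (`L ≥ 1`, `γ ≥ 0`). [cite: Balaban1985UV3, (5) p.256] -/
theorem coupling_le_of_le (hL : 1 ≤ L) (hγ : 0 ≤ γ) {i j : ℕ} (hij : i ≤ j) :
    Real.sqrt (γ * ((L : ℝ)⁻¹) ^ j) ≤ Real.sqrt (γ * ((L : ℝ)⁻¹) ^ i) := by
  refine Real.sqrt_le_sqrt (mul_le_mul_of_nonneg_left ?_ hγ)
  exact pow_le_pow_of_le_one (inv_nonneg_le_one hL).1 (inv_nonneg_le_one hL).2 hij

/-- `θ(i) = g_i·p(g_i)` unfolded (`rfl`). [cite: Balaban1985UV3, (7) p.257] -/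
theorem θBal_eq (L : ℕ) (γ b₀ p₀ : ℝ) (i : ℕ) :
    θBal L γ b₀ p₀ i = Real.sqrt (γ * ((L : ℝ)⁻¹) ^ i) * B10.pFun b₀ p₀ (Real.sqrt (γ * ((L : ℝ)⁻¹) ^ i)) := rfl

end Coupling

/-! ## §2 Uniform smallness: `θ(i) ≤ C(b₀,p₀)·√g_i ≤ C(b₀,p₀)·γ^{1/4}`, one threshold, the `∀ ε₀ ∃ γ₁` form -/

section Uniform

variable {L : ℕ} {γ b₀ p₀ : ℝ}

/-- **`g·p(g) ≤ b₀(2p₀)^{p₀}e^{½−p₀}·√g` on `(0, 1]`** (`b₀ ≥ 0`, `p₀ > 0`): the tangent-line bound `B10.rpow_mul_exp_neg_le` with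
`c = ½` — half of the decay `g = e^{−log g⁻¹}` pays for the logarithmic growth of `p(g)` (the lane's `CouplingWindow.gp_le_sqrt`,
re-derived inside the Literature import cone for the d = 3 family's couplings). [cite: Balaban1985UV3, (7) p.257] -/
theorem gp_le_const_mul_sqrt {g : ℝ} (hb : 0 ≤ b₀) (hp : 0 < p₀) (hg : 0 < g) (hg1 : g ≤ 1) :
    g * B10.pFun b₀ p₀ g ≤ b₀ * ((2 * p₀) ^ p₀ * Real.exp (1 / 2 - p₀)) * Real.sqrt g := by
  have hu := B10.log_inv_nonneg_of_le_one hg hg1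
  set u := Real.log g⁻¹ with hu_def
  have hcore := B10.rpow_mul_exp_neg_le p₀ (1 / 2) u hp (by norm_num) (by linarith)
  rw [show p₀ / (1 / 2) = 2 * p₀ by ring] at hcore
  have hg_exp : g = Real.exp (-u) := by
    rw [hu_def, Real.log_inv, neg_neg, Real.exp_log hg]
  have hsqrt : Real.sqrt g = Real.exp (-(1 / 2 * u)) := by
    rw [hg_exp, ← Real.exp_half]
    congr 1
    ring
  have hsplit : Real.exp (-u) = Real.exp (-(1 / 2 * u)) * Real.exp (-(1 / 2 * u)) := by
    rw [← Real.exp_add]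
    congr 1
    ring
  have hK : 0 ≤ b₀ * Real.exp (-(1 / 2 * u)) := mul_nonneg hb (Real.exp_pos _).le
  calc g * B10.pFun b₀ p₀ g
      = (b₀ * Real.exp (-(1 / 2 * u))) * ((1 + u) ^ p₀ * Real.exp (-(1 / 2 * u))) := by
        unfold B10.pFun
        rw [← hu_def, hg_exp, hsplit]
        ring
    _ ≤ (b₀ * Real.exp (-(1 / 2 * u))) * ((2 * p₀) ^ p₀ * Real.exp (1 / 2 - p₀)) :=
        mul_le_mul_of_nonneg_left hcore hK
    _ = b₀ * ((2 * p₀) ^ p₀ * Real.exp (1 / 2 - p₀)) * Real.sqrt g := by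
        rw [hsqrt]
        ring

/-- **`θ(i) ≤ b₀(2p₀)^{p₀}e^{½−p₀}·√g_i`** (`L ≥ 1`, `0 < γ ≤ 1`, `b₀ ≥ 0`, `p₀ > 0`). [cite: Balaban1985UV3, (7) p.257] -/
theorem θBal_le_const_mul_sqrt_coupling (hL : 1 ≤ L) (hγ : 0 < γ) (hγ1 : γ ≤ 1) (hb : 0 ≤ b₀) (hp : 0 < p₀) (i : ℕ) :
    θBal L γ b₀ p₀ i ≤
      b₀ * ((2 * p₀) ^ p₀ * Real.exp (1 / 2 - p₀)) * Real.sqrt (Real.sqrt (γ * ((L : ℝ)⁻¹) ^ i)) := by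
  rw [θBal_eq]
  exact gp_le_const_mul_sqrt hb hp (sqrt_coupling_pos_le hL hγ i).1 (coupling_le_one hL hγ hγ1 i)

/-- **`θ(i) ≤ b₀(2p₀)^{p₀}e^{½−p₀}·√(√γ)` UNIFORMLY in `i` and in `L ≥ 1`** (`0 < γ ≤ 1`, `b₀ ≥ 0`, `p₀ > 0`): the thresholds at
every distance from the unit scale are controlled by the unit-scale coupling alone. [cite: Balaban1985UV3, (7) p.257] -/
theorem θBal_le_const_mul_rpow (hL : 1 ≤ L) (hγ : 0 < γ) (hγ1 : γ ≤ 1) (hb : 0 ≤ b₀) (hp : 0 < p₀) (i : ℕ) :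
    θBal L γ b₀ p₀ i ≤ b₀ * ((2 * p₀) ^ p₀ * Real.exp (1 / 2 - p₀)) * Real.sqrt (Real.sqrt γ) := by
  refine (θBal_le_const_mul_sqrt_coupling hL hγ hγ1 hb hp i).trans ?_
  have hC : 0 ≤ b₀ * ((2 * p₀) ^ p₀ * Real.exp (1 / 2 - p₀)) := by positivity
  exact mul_le_mul_of_nonneg_left (Real.sqrt_le_sqrt (sqrt_coupling_pos_le hL hγ i).2) hC

/-- **ONE THRESHOLD**: if `0 < γ ≤ 1` and `γ ≤ ((σ / (b₀(2p₀)^{p₀}e^{½−p₀}))²)²` (`b₀, p₀ > 0`, `σ ≥ 0`), then `θ(i) ≤ σ` for EVERY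
`i` and every `L ≥ 1` — how «for `g_k` sufficiently small» (p. 267 L9, p. 273 L27) is read along the d = 3 family, where every
coupling is below the unit-scale one. [cite: Balaban1985UV3, (7) p.257, p.267] -/
theorem θBal_le_of_le_gamma (hL : 1 ≤ L) (hb : 0 < b₀) (hp : 0 < p₀) {σ : ℝ} (hσ : 0 ≤ σ) (hγ : 0 < γ) (hγ1 : γ ≤ 1)
    (hγσ : γ ≤ ((σ / (b₀ * ((2 * p₀) ^ p₀ * Real.exp (1 / 2 - p₀)))) ^ 2) ^ 2) (i : ℕ) :
    θBal L γ b₀ p₀ i ≤ σ := by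
  set C := b₀ * ((2 * p₀) ^ p₀ * Real.exp (1 / 2 - p₀)) with hC_def
  have hC : 0 < C := by positivity
  have hσC : 0 ≤ σ / C := div_nonneg hσ hC.le
  have hsq : Real.sqrt (Real.sqrt γ) ≤ σ / C := by
    calc Real.sqrt (Real.sqrt γ) ≤ Real.sqrt (Real.sqrt (((σ / C) ^ 2) ^ 2)) :=
          Real.sqrt_le_sqrt (Real.sqrt_le_sqrt hγσ)
      _ = σ / C := by rw [Real.sqrt_sq (sq_nonneg _), Real.sqrt_sq hσC]
  calc θBal L γ b₀ p₀ i ≤ C * Real.sqrt (Real.sqrt γ) := θBal_le_const_mul_rpow hL hγ hγ1 hb.le hp i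
    _ ≤ C * (σ / C) := mul_le_mul_of_nonneg_left hsq hC.le
    _ = σ := by field_simp

/-- **`∀ σ > 0, ∃ γ₁ ∈ (0,1], ∀ L ≥ 1, ∀ γ ∈ (0,γ₁], ∀ i, θ(i) ≤ σ`** (`b₀, p₀ > 0`) with the EXPLICIT `γ₁ = min 1 ((σ/C)²)²`,
`C = b₀(2p₀)^{p₀}e^{½−p₀}`, uniform in `L ≥ 1` as well (`T3ThresholdSmallness.exists_forall_θBal_le` is the qualitative form at
fixed `L`, for every real `p₀`) — the order «`ε₀` first, then `γ₁(ε₀)`» of the route's prefix. [cite: Balaban1985UV3, (7) p.257, p.267] -/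
theorem exists_gamma_forall_θBal_le (hb : 0 < b₀) (hp : 0 < p₀) {σ : ℝ} (hσ : 0 < σ) :
    ∃ γ₁ : ℝ, 0 < γ₁ ∧ γ₁ ≤ 1 ∧
      ∀ L : ℕ, 1 ≤ L → ∀ γ : ℝ, 0 < γ → γ ≤ γ₁ → ∀ i : ℕ, θBal L γ b₀ p₀ i ≤ σ := by
  set C := b₀ * ((2 * p₀) ^ p₀ * Real.exp (1 / 2 - p₀)) with hC_def
  have hC : 0 < C := by positivity
  refine ⟨min 1 (((σ / C) ^ 2) ^ 2), lt_min one_pos (by positivity), min_le_left _ _, ?_⟩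
  intro L hL γ hγ hγ₁ i
  exact θBal_le_of_le_gamma hL hb hp hσ.le hγ (hγ₁.trans (min_le_left _ _)) (hγ₁.trans (min_le_right _ _)) i

/-- **`∀ ε₀ > 0, ∃ γ₁ ∈ (0,1], ∀ L ≥ 1, ∀ γ ∈ (0,γ₁], ∀ i, B·θ(i) ≤ ε₀`** for a constant `B ≥ 0` (e.g. `B = B₃` of
[Balaban1985Variational] Thm 1, or `B = C·L·B₃` of an interpolation step): hypothesis «`B₃ε₁ ≤ ε₀`» of Thm 1 at `ε₁ = θ(i)` holds at
EVERY distance `i` once `γ ≤ γ₁(ε₀)`. [cite: Balaban1985Variational, Thm 1 p.279] -/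
theorem exists_gamma_forall_mul_θBal_le (hb : 0 < b₀) (hp : 0 < p₀) {B : ℝ} (hB : 0 ≤ B) {ε₀ : ℝ} (hε : 0 < ε₀) :
    ∃ γ₁ : ℝ, 0 < γ₁ ∧ γ₁ ≤ 1 ∧
      ∀ L : ℕ, 1 ≤ L → ∀ γ : ℝ, 0 < γ → γ ≤ γ₁ → ∀ i : ℕ, B * θBal L γ b₀ p₀ i ≤ ε₀ := by
  obtain ⟨γ₁, hγ₁, hγ₁1, h⟩ := exists_gamma_forall_θBal_le (b₀ := b₀) (p₀ := p₀) hb hp (σ := ε₀ / (B + 1)) (by positivity)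
  refine ⟨γ₁, hγ₁, hγ₁1, fun L hL γ hγ hγγ₁ i => ?_⟩
  have hθ := h L hL γ hγ hγγ₁ i
  have hθ0 : 0 ≤ θBal L γ b₀ p₀ i := (θBal_pos hL hγ (hγγ₁.trans hγ₁1) hb p₀ i).le
  calc B * θBal L γ b₀ p₀ i ≤ (B + 1) * (ε₀ / (B + 1)) :=
        mul_le_mul (by linarith) hθ hθ0 (by linarith)
    _ = ε₀ := by field_simp

end Uniform

/-! ## §3 The «from some `K₀` on» form at `i = ⌊K/m⌋` of the decay `θ(i) → 0` (`T3ThresholdSmallness.tendsto_θBal_atTop`) -/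

section Decay

variable {L : ℕ} {γ b₀ p₀ : ℝ}

/-- **«FROM SOME `K₀` ON»**: at fixed `0 < γ ≤ 1`, `L > 1`, `0 < m`, for every `σ > 0` there is `K₀` with `θ(⌊K/m⌋) ≤ σ` for all
`K ≥ K₀` — so hypothesis «`B₃ε₁ ≤ ε₀`» of [Balaban1985Variational] Thm 1 at `ε₁ = θ(⌊K/m⌋)` holds eventually in `K` at fixed
coupling (the `∃ K₀` of the schemas `HasRegMinimisersPrAt` & co.). [cite: Balaban1985Variational, Thm 1 p.279] -/
theorem eventually_θBal_div_le (hL : 1 < L) (hγ : 0 < γ) (b₀ p₀ : ℝ) {m : ℕ} (hm : 0 < m) {σ : ℝ} (hσ : 0 < σ) :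
    ∃ K₀ : ℕ, ∀ K : ℕ, K₀ ≤ K → θBal L γ b₀ p₀ (K / m) ≤ σ := by
  obtain ⟨N, hN⟩ := eventually_atTop.mp ((tendsto_θBal_atTop hL hγ b₀ p₀).eventually (ge_mem_nhds hσ))
  refine ⟨N * m, fun K hK => hN (K / m) ?_⟩
  exact (Nat.le_div_iff_mul_le hm).mpr hK

/-- The same with a constant: `∀ ε₀ > 0, ∃ K₀, ∀ K ≥ K₀, B·θ(⌊K/m⌋) ≤ ε₀` (`B ≥ 0`, fixed `0 < γ ≤ 1`, `L > 1`, `0 < m`, `b₀ > 0`) —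
hypothesis «`B₃ε₁ ≤ ε₀`» of [Balaban1985Variational] Thm 1 at `ε₁ = θ(⌊K/m⌋)` eventually in `K`. [cite: Balaban1985Variational, Thm 1 p.279] -/
theorem eventually_mul_θBal_div_le (hL : 1 < L) (hγ : 0 < γ) (hγ1 : γ ≤ 1) (hb : 0 < b₀) (p₀ : ℝ) {m : ℕ} (hm : 0 < m)
    {B : ℝ} (hB : 0 ≤ B) {ε₀ : ℝ} (hε : 0 < ε₀) : ∃ K₀ : ℕ, ∀ K : ℕ, K₀ ≤ K → B * θBal L γ b₀ p₀ (K / m) ≤ ε₀ := by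
  obtain ⟨K₀, h⟩ := eventually_θBal_div_le hL hγ b₀ p₀ hm (σ := ε₀ / (B + 1)) (by positivity)
  refine ⟨K₀, fun K hK => ?_⟩
  have hθ0 : 0 ≤ θBal L γ b₀ p₀ (K / m) := (θBal_pos hL.le hγ hγ1 hb p₀ (K / m)).le
  calc B * θBal L γ b₀ p₀ (K / m) ≤ (B + 1) * (ε₀ / (B + 1)) := mul_le_mul (by linarith) (h K hK) hθ0 (by linarith)
    _ = ε₀ := by field_simp

end Decay

/-! ## §4 Monotonicity: `g ↦ g·p(g)` increases on `(0, e^{1−p₀}]`; `θ(i+1) ≤ θ(i) ≤ θ(0)` once `√γ ≤ e^{1−p₀}` -/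

section Monotone

variable {L : ℕ} {γ b₀ p₀ : ℝ}

/-- Core inequality behind the monotonicity of the window `g(1 + log g⁻¹)^{p₀}` of (7) p. 257 in the variable `u = log g⁻¹`: for
`0 ≤ u' ≤ u` with `p₀ ≤ 1 + u'` (`p₀ ≥ 0`), `e^{−u}(1+u)^{p₀} ≤ e^{−u'}(1+u')^{p₀}` — write `1 + u = (1 + u')(1 + t)`,
`(1 + t)^{p₀} ≤ e^{p₀t} ≤ e^{u−u'}` since `p₀/(1+u') ≤ 1`. [cite: Balaban1985UV3, (7) p.257] -/
theorem exp_neg_mul_rpow_le {u u' : ℝ} (hp : 0 ≤ p₀) (hu' : 0 ≤ u') (huu' : u' ≤ u) (hpu : p₀ ≤ 1 + u') :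
    Real.exp (-u) * (1 + u) ^ p₀ ≤ Real.exp (-u') * (1 + u') ^ p₀ := by
  have h1 : 0 < 1 + u' := by linarith
  set t := (u - u') / (1 + u') with ht
  have ht0 : 0 ≤ t := div_nonneg (by linarith) h1.le
  have hsplit : 1 + u = (1 + u') * (1 + t) := by
    rw [ht]; field_simp; ring
  have hrpow : (1 + u) ^ p₀ = (1 + u') ^ p₀ * (1 + t) ^ p₀ := by
    rw [hsplit, Real.mul_rpow h1.le (by linarith)]
  have htp : t * p₀ ≤ u - u' := by
    have : t * p₀ = (u - u') * (p₀ / (1 + u')) := by rw [ht]; ring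
    rw [this]
    exact mul_le_of_le_one_right (by linarith) ((div_le_one h1).mpr hpu)
  have hexp : (1 + t) ^ p₀ ≤ Real.exp (u - u') :=
    calc (1 + t) ^ p₀ ≤ (Real.exp t) ^ p₀ :=
          Real.rpow_le_rpow (by linarith) (by linarith [Real.add_one_le_exp t]) hp
      _ = Real.exp (t * p₀) := (Real.exp_mul t p₀).symm
      _ ≤ Real.exp (u - u') := Real.exp_le_exp.mpr htp
  have hr0 : 0 ≤ (1 + u') ^ p₀ := Real.rpow_nonneg h1.le p₀
  calc Real.exp (-u) * (1 + u) ^ p₀ = Real.exp (-u) * ((1 + u') ^ p₀ * (1 + t) ^ p₀) := by rw [hrpow]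
    _ ≤ Real.exp (-u) * ((1 + u') ^ p₀ * Real.exp (u - u')) :=
        mul_le_mul_of_nonneg_left (mul_le_mul_of_nonneg_left hexp hr0) (Real.exp_pos _).le
    _ = (Real.exp (-u) * Real.exp (u - u')) * (1 + u') ^ p₀ := by ring
    _ = Real.exp (-u') * (1 + u') ^ p₀ := by rw [← Real.exp_add, show -u + (u - u') = -u' by ring]

/-- **`g·p(g) ≤ g'·p(g')` for `0 < g ≤ g' ≤ min(1, e^{1−p₀})`** (`b₀, p₀ ≥ 0`): the threshold function `g(1 + log g⁻¹)^{p₀}` is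
INCREASING below `e^{1−p₀}` (its `g`-derivative is `(1 + log g⁻¹)^{p₀−1}(1 + log g⁻¹ − p₀)`). [cite: Balaban1985UV3, (7) p.257] -/
theorem gp_le_gp_of_le {g g' : ℝ} (hb : 0 ≤ b₀) (hp : 0 ≤ p₀) (hg : 0 < g) (hgg' : g ≤ g') (hg'1 : g' ≤ 1)
    (hg'e : g' ≤ Real.exp (1 - p₀)) : g * B10.pFun b₀ p₀ g ≤ g' * B10.pFun b₀ p₀ g' := by
  have hg' : 0 < g' := hg.trans_le hgg'
  have hu' : 0 ≤ Real.log g'⁻¹ := B10.log_inv_nonneg_of_le_one hg' hg'1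
  have huu' : Real.log g'⁻¹ ≤ Real.log g⁻¹ := Real.log_le_log (inv_pos.mpr hg') (inv_anti₀ hg hgg')
  have hpu : p₀ ≤ 1 + Real.log g'⁻¹ := by
    have h := Real.log_le_log hg' hg'e
    rw [Real.log_exp] at h
    rw [Real.log_inv]
    linarith
  have key := exp_neg_mul_rpow_le hp hu' huu' hpu
  have hg_exp : Real.exp (-Real.log g⁻¹) = g := by rw [Real.log_inv, neg_neg, Real.exp_log hg]
  have hg'_exp : Real.exp (-Real.log g'⁻¹) = g' := by rw [Real.log_inv, neg_neg, Real.exp_log hg']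
  rw [hg_exp, hg'_exp] at key
  unfold B10.pFun
  calc g * (b₀ * (1 + Real.log g⁻¹) ^ p₀) = b₀ * (g * (1 + Real.log g⁻¹) ^ p₀) := by ring
    _ ≤ b₀ * (g' * (1 + Real.log g'⁻¹) ^ p₀) := mul_le_mul_of_nonneg_left key hb
    _ = g' * (b₀ * (1 + Real.log g'⁻¹) ^ p₀) := by ring

/-- **`θ(i+1) ≤ θ(i)` once `√γ ≤ e^{1−p₀}`** (`L ≥ 1`, `0 < γ ≤ 1`, `b₀, p₀ ≥ 0`): away from the unit scale the thresholds shrink.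
[cite: Balaban1985UV3, (7) p.257] -/
theorem θBal_succ_le (hL : 1 ≤ L) (hγ : 0 < γ) (hγ1 : γ ≤ 1) (hγe : Real.sqrt γ ≤ Real.exp (1 - p₀)) (hb : 0 ≤ b₀)
    (hp : 0 ≤ p₀) (i : ℕ) : θBal L γ b₀ p₀ (i + 1) ≤ θBal L γ b₀ p₀ i := by
  rw [θBal_eq, θBal_eq]
  exact gp_le_gp_of_le hb hp (sqrt_coupling_pos_le hL hγ (i + 1)).1 (coupling_succ_le hL hγ.le i)
    (coupling_le_one hL hγ hγ1 i) ((sqrt_coupling_pos_le hL hγ i).2.trans hγe)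

/-- **`θ` is ANTITONE in the distance from the unit scale** once `√γ ≤ e^{1−p₀}`. [cite: Balaban1985UV3, (7) p.257] -/
theorem θBal_antitone (hL : 1 ≤ L) (hγ : 0 < γ) (hγ1 : γ ≤ 1) (hγe : Real.sqrt γ ≤ Real.exp (1 - p₀)) (hb : 0 ≤ b₀)
    (hp : 0 ≤ p₀) : Antitone (θBal L γ b₀ p₀) :=
  antitone_nat_of_succ_le fun i => θBal_succ_le hL hγ hγ1 hγe hb hp i

/-- `θ(j) ≤ θ(i)` for `i ≤ j` once `√γ ≤ e^{1−p₀}` — e.g. `PlaqSmall θ(j) ⇒ PlaqSmall θ(i)`-type height comparisons.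
[cite: Balaban1985UV3, (7) p.257] -/
theorem θBal_le_of_le (hL : 1 ≤ L) (hγ : 0 < γ) (hγ1 : γ ≤ 1) (hγe : Real.sqrt γ ≤ Real.exp (1 - p₀)) (hb : 0 ≤ b₀)
    (hp : 0 ≤ p₀) {i j : ℕ} (hij : i ≤ j) : θBal L γ b₀ p₀ j ≤ θBal L γ b₀ p₀ i :=
  θBal_antitone hL hγ hγ1 hγe hb hp hij

/-- `θ(0) = √γ·p(√γ)`: the unit-scale threshold. [cite: Balaban1985UV3, (7) p.257] -/
theorem θBal_zero (L : ℕ) (γ b₀ p₀ : ℝ) : θBal L γ b₀ p₀ 0 = Real.sqrt γ * B10.pFun b₀ p₀ (Real.sqrt γ) := by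
  rw [θBal_eq, pow_zero, mul_one]

/-- **`θ(i) ≤ θ(0) = √γ·p(√γ)` for every `i`** once `√γ ≤ e^{1−p₀}`: all heights' thresholds are below the unit-scale one, which
tends to `0` with `γ`. [cite: Balaban1985UV3, (7) p.257] -/
theorem θBal_le_θBal_zero (hL : 1 ≤ L) (hγ : 0 < γ) (hγ1 : γ ≤ 1) (hγe : Real.sqrt γ ≤ Real.exp (1 - p₀)) (hb : 0 ≤ b₀)
    (hp : 0 ≤ p₀) (i : ℕ) : θBal L γ b₀ p₀ i ≤ Real.sqrt γ * B10.pFun b₀ p₀ (Real.sqrt γ) := by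
  rw [← θBal_zero L γ b₀ p₀]
  exact θBal_le_of_le hL hγ hγ1 hγe hb hp (Nat.zero_le i)

/-- The monotonicity window of the thresholds (7) p. 257 as a threshold on the coupling `γ`: `√γ ≤ e^{1−p₀}` iff `γ ≤ e^{2(1−p₀)}`
(`γ ≥ 0`). [cite: Balaban1985UV3, (7) p.257] -/
theorem sqrt_le_exp_iff {γ p₀ : ℝ} (hγ : 0 ≤ γ) : Real.sqrt γ ≤ Real.exp (1 - p₀) ↔ γ ≤ Real.exp (2 * (1 - p₀)) := by
  have he : 0 < Real.exp (1 - p₀) := Real.exp_pos _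
  have hsq : Real.exp (2 * (1 - p₀)) = Real.exp (1 - p₀) ^ 2 := by
    rw [sq, ← Real.exp_add]
    ring_nf
  rw [hsq]
  constructor
  · intro h
    nlinarith [Real.sq_sqrt hγ, Real.sqrt_nonneg γ, h, he.le]
  · intro h
    calc Real.sqrt γ ≤ Real.sqrt (Real.exp (1 - p₀) ^ 2) := Real.sqrt_le_sqrt h
      _ = Real.exp (1 - p₀) := Real.sqrt_sq he.le

end Monotone



end Literature.MathematicalPhysics.QuantumFieldTheory.Balaban1983to89.T3Thresholds

end
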